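import Literature.MathematicalPhysics.QuantumFieldTheory.Balaban1983to89.B11Eq118RegimeScalars

/-!
# `Balaban1983to89.B11Eq118RegimeScalarsDependent` — T. Bałaban, *The variational problem and background fields in renormalization group method for lattice gauge theories*, Commun. Math. Phys. **102** (1985) 277–309 [Balaban1985Variational]: Prop. 6 (117)–(121) p. 295 and Sect. C (62) p. 287 — THE SCALAR LETTERS OF THE TWO CONTRACTION REGIMES WHEN THE W-SLOT's QUADRATIC-ANALYTICITY CONSTANTS DEPEND ON THE SECT. C RADII: Sect. C scalars FIRST (under a cap), THEN the W-regime scalars for `(C₄(a_C, ε_C), a₃(a_C, ε_C))` under an inner cap `κ(a_C, ε_C)`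

statement-level skeleton of published theorems with citation tags; proofs where landed; nothing here is a claim about the Yang–Mills mass gap

CITATION HEADER (lean-in-tree rule 2026-08-18).  WHAT IS REPRODUCED: nothing of print is asserted beyond the tree's `B11Eq118RegimeScalars` (the OWNER
lineage's «for ε₁ sufficiently small» made explicit).  Cell context (pub-balaban, NE9 chain): the consumer `Support/NE9CurChartLipschitzAtFlat` ((Z)) chooses
its two regimes by `exists_twoRegimes_radii_of_bounds_room_cap` with the W-slot's `(C₄, a₃)` GIVEN IN ADVANCE; inhabiting the (L3) slot by the genuine
`W80` (OFFER O-ne9p1-g83-3, `Support/NE9CurChartLipschitzAtFlatW80`) meets two obstructions of ORDER: (i) `W80`'s `(C₄, R′)` are produced by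
`B11Ineq73KernelLettersUniform.exists_quadAnalytic_W80_uniform` FROM the Sect. C scalars `(b, C₂, c₄, a_C, ε_C)`, so they cannot precede the choice of
`(a_C, ε_C)`; (ii) the W80 background modulus (`B11Eq98W80BackgroundModulus.exists_W80_background_modulus`) is valid on balls of radius
`r ≤ a_C/(2K_ι²)` and `r ≤ R_V(1 − 4bC₂(ε_C + a_C))/(4K_ι)` only, while (Z) reads it on `r = ε₄ + a ≤ a_C`.  THIS FILE is the scalar lemma that removes
both: the Sect. C scalars are chosen first, the W-regime scalars afterwards for ARBITRARY constant-functions `C₄(a_C, ε_C) ≥ 0`, `a₃(a_C, ε_C) > 0` and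
under an ARBITRARY positive inner cap `κ(a_C, ε_C)` (e.g. `min (a_C/(2K_ι²)) (R_V/(6K_ι))`).

WHAT IS PROVED (sorry-free; real arithmetic; 0 def).  **`exists_twoRegimes_radii_dep_cap`** — for bounds `B₀, b, b₁ ≥ 0`, Sect. C constants `C₂ ≥ 0`,
`c₄ > 0`, a cap `δ > 0`, and functions `C₄f a₃f κf : ℝ → ℝ → ℝ` with `0 ≤ C₄f`, `0 < a₃f`, `0 < κf` at every `a_C > 0`, `ε_C > 0`: there are
`j a ε₄ a_C ε_C R_b > 0` with `ε₄ + a ≤ a_C`, `ε₄ + a ≤ κf a_C ε_C`, `ε_C + a_C ≤ δ`, the «room» inequalities `6(ε₄ + a) ≤ a₃f a_C ε_C`,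
`12B₀(C₄f a_C ε_C)(ε₄ + a) < 1`, `6(ε_C + a_C) ≤ c₄`, `12bC₂(ε_C + a_C) < 1`, and for ALL spaces and operators under the bounds:
`Regime 𝒢 0 W B₀ 0 (C₄f a_C ε_C) (a₃f a_C ε_C) j a ε₄` whenever `QuadAnalytic W (C₄f a_C ε_C) (a₃f a_C ε_C)`, `Regime H 0 C b 0 C₂ c₄ 0 a_C ε_C` whenever
`QuadAnalytic C C₂ c₄`, and `‖H₁B‖ < a` on `ball 0 R_b` — `exists_twoRegimes_radii_of_bounds_room_cap` with the quantifier order the W80 inhabitation needs.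

HONEST SCOPE.  Abstract real arithmetic on the tree's `exists_regime_scalars` ∕ `Regime.of_normBound_zeroLinear`; the bounds themselves are NOT derived;
NOT the (Z)+W80 composition (only its scalar step); NOT summit progress (cell pub-balaban: NE9 NOT PRINTED ∕ NOT PROVED; «NE9 ⇐ the named binders»; spine
PROVED 0/9; HONEST DEPENDENCY: continuum YM on T⁴ ⇐ BetaPertH ∧ nine spine estimates (0/9 proved); BetaPertH ⇐ (D1) ∧ (D4) ∧ CAP+tail; G-an2-4 gates asym,
D1 and NE2/3/4).  Unit `b2b-balaban-t4-ne9-formalise-leaf-05` (NE9 crux-team leaf prover, gen 71).  Imports `B11Eq118RegimeScalars` ONLY; modifies nothing.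
-/

noncomputable section

namespace Literature.MathematicalPhysics.QuantumFieldTheory.Balaban1983to89.B11Eq118RegimeScalarsDependent

open Metric Set
open Literature.MathematicalPhysics.QuantumFieldTheory.Balaban1983to89.B13Contraction113 (QuadAnalytic)
open Literature.MathematicalPhysics.QuantumFieldTheory.Balaban1983to89.B11Eq174Chart (Regime)
open Literature.MathematicalPhysics.QuantumFieldTheory.Balaban1983to89.B11Eq118RegimeRadiiUniform (Regime.of_normBound_zeroLinear)
open Literature.MathematicalPhysics.QuantumFieldTheory.Balaban1983to89.B11Eq118RegimeScalars (exists_regime_scalars)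

/-- **THE TWO REGIMES' SCALARS WITH THE W-SLOT's CONSTANTS DEPENDING ON THE SECT. C RADII** — see the module header: Sect. C scalars `(a_C, ε_C)` first
(at `(3C₂, c₄/3)`, under the cap `δ`), then the W-regime scalars `(j, a, ε₄)` for `(3·C₄f a_C ε_C, a₃f a_C ε_C/3)` under the cap
`min a_C (κf a_C ε_C)`; `R_b := a/(b₁ + 1)`. [cite: Balaban1985Variational, Prop. 6 (117)–(121) p.295, (62) p.287] -/
theorem exists_twoRegimes_radii_dep_cap {B₀ b b₁ C₂ c₄ δ : ℝ} (hB₀ : 0 ≤ B₀) (hb : 0 ≤ b) (hb₁ : 0 ≤ b₁) (hC₂ : 0 ≤ C₂) (hc₄ : 0 < c₄)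
    (hδ : 0 < δ) (C₄f a₃f κf : ℝ → ℝ → ℝ) (hC₄f : ∀ aC εC, 0 < aC → 0 < εC → 0 ≤ C₄f aC εC)
    (ha₃f : ∀ aC εC, 0 < aC → 0 < εC → 0 < a₃f aC εC) (hκf : ∀ aC εC, 0 < aC → 0 < εC → 0 < κf aC εC) :
    ∃ j a ε₄ aC εC Rb : ℝ, 0 < j ∧ 0 < a ∧ 0 < ε₄ ∧ 0 < aC ∧ 0 < εC ∧ 0 < Rb ∧ ε₄ + a ≤ aC ∧ ε₄ + a ≤ κf aC εC ∧ εC + aC ≤ δ ∧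
      (6 * (ε₄ + a) ≤ a₃f aC εC ∧ 12 * B₀ * C₄f aC εC * (ε₄ + a) < 1 ∧ 6 * (εC + aC) ≤ c₄ ∧ 12 * b * C₂ * (εC + aC) < 1) ∧
      ∀ {𝒴 : Type*} [NormedAddCommGroup 𝒴] [NormedSpace ℂ 𝒴] {𝒵 : Type*} [NormedAddCommGroup 𝒵] [NormedSpace ℂ 𝒵]
        {𝒳 : Type*} [NormedAddCommGroup 𝒳] [NormedSpace ℂ 𝒳] {ℬ : Type*} [NormedAddCommGroup ℬ] [NormedSpace ℂ ℬ]
        (𝒢 : 𝒵 →L[ℂ] 𝒴) (W : 𝒴 → 𝒵) (H : 𝒳 →L[ℂ] 𝒴) (C : 𝒴 → 𝒳) (H₁ : ℬ →L[ℂ] 𝒴),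
        (∀ f, ‖𝒢 f‖ ≤ B₀ * ‖f‖) → QuadAnalytic W (C₄f aC εC) (a₃f aC εC) → (∀ Y, ‖H Y‖ ≤ b * ‖Y‖) → QuadAnalytic C C₂ c₄ →
        (∀ B, ‖H₁ B‖ ≤ b₁ * ‖B‖) →
        Regime 𝒢 0 W B₀ 0 (C₄f aC εC) (a₃f aC εC) j a ε₄ ∧ Regime H 0 C b 0 C₂ c₄ 0 aC εC ∧ ∀ B ∈ ball (0 : ℬ) Rb, ‖H₁ B‖ < a := by
  have hC₂3 : 0 ≤ 3 * C₂ := by positivity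
  -- Sect. C radii first, under the cap `δ`
  obtain ⟨j₁, aC, εC, hj₁, haC, hεC, hcapC, hCdom, hCself, hCcontr⟩ := exists_regime_scalars hb hC₂3 (by positivity : 0 < c₄ / 3) hδ
  -- then the W-regime radii for the constants AT `(a_C, ε_C)`, under the cap `min a_C (κf a_C ε_C)`
  have hC₄ : 0 ≤ C₄f aC εC := hC₄f aC εC haC hεC
  have ha₃ : 0 < a₃f aC εC := ha₃f aC εC haC hεC
  have hκ : 0 < κf aC εC := hκf aC εC haC hεC
  have hC₄3 : 0 ≤ 3 * C₄f aC εC := by positivity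
  obtain ⟨j, a, ε₄, hj, ha, hε₄, hcap, hdom, hself, hcontr⟩ :=
    exists_regime_scalars hB₀ hC₄3 (by positivity : 0 < a₃f aC εC / 3) (lt_min haC hκ)
  have hm : 0 ≤ ε₄ + a := by linarith
  have hmC : 0 ≤ εC + aC := by linarith
  have hself' : B₀ * j + B₀ * C₄f aC εC * (ε₄ + a) ^ 2 ≤ ε₄ := by nlinarith [mul_nonneg hB₀ hC₄, sq_nonneg (ε₄ + a)]
  have hcontr' : 4 * B₀ * C₄f aC εC * (ε₄ + a) < 1 := by nlinarith [mul_nonneg (mul_nonneg hB₀ hC₄) hm]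
  have hCself' : b * 0 + b * C₂ * (εC + aC) ^ 2 ≤ εC := by
    have h0 : 0 ≤ b * j₁ := mul_nonneg hb hj₁.le
    nlinarith [mul_nonneg hb hC₂, sq_nonneg (εC + aC)]
  have hCcontr' : 4 * b * C₂ * (εC + aC) < 1 := by nlinarith [mul_nonneg (mul_nonneg hb hC₂) hmC]
  refine ⟨j, a, ε₄, aC, εC, a / (b₁ + 1), hj, ha, hε₄, haC, hεC, by positivity, hcap.trans (min_le_left _ _),
    hcap.trans (min_le_right _ _), hcapC, ⟨by linarith, by linarith, by linarith, by linarith⟩, ?_⟩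
  intro 𝒴 _ _ 𝒵 _ _ 𝒳 _ _ ℬ _ _ 𝒢 W H C H₁ h𝒢 hW hH hC hH₁
  refine ⟨Regime.of_normBound_zeroLinear 𝒢 hB₀ h𝒢 hW hC₄ hε₄.le (by linarith) hself' hcontr',
    Regime.of_normBound_zeroLinear H hb hH hC hC₂ hεC.le (by linarith) hCself' hCcontr', fun B hB => ?_⟩
  rw [mem_ball_zero_iff] at hB
  have h1 := hH₁ B
  have h2 : b₁ * ‖B‖ < a := by
    have : b₁ * ‖B‖ ≤ b₁ * (a / (b₁ + 1)) := mul_le_mul_of_nonneg_left hB.le hb₁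
    refine this.trans_lt ?_
    rw [mul_div_assoc', div_lt_iff₀ (by positivity)]
    nlinarith
  exact h1.trans_lt h2

end Literature.MathematicalPhysics.QuantumFieldTheory.Balaban1983to89.B11Eq118RegimeScalarsDependent

end
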